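import Literature.Analysis.FunctionSpaces.LittlewoodPaleyMultiplierProofs
import Literature.Analysis.FunctionSpaces.LittlewoodPaleyConvergenceProofs
import HarnessLib

/-!
# Strong continuity of the heat semigroup on `Ḃ^s_{p,q}` (`q < ∞`, all `1 ≤ p ≤ ∞`), blockwise,
# uniformly on `ℓ^q`-profiles, and the smallness of the Kato norm of the free flow at `t → 0⁺`

Analysis/FunctionSpaces proof file (no definitions, no named facts), sibling of
`LittlewoodPaleyHeatProofs.lean` (`‖e^{tΔ}Δ̇_j u‖_{L^p} ≲ e^{-ct4^j}‖Δ̇_j u‖_{L^p}`) and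
`LittlewoodPaleyMultiplierProofs.lean` (the multiplier lemma on the blocks with a bound linear in
the rescaled symbol). Everything is proved at the level of tempered distributions and Fourier
multipliers, in every dimension and for every `1 ≤ p ≤ ∞`:

* `norm_iteratedFDeriv_heatSymbol_sub_one_le`: the symbol `e^{-(2π)²r‖ξ‖²} - 1` of `e^{rΔ} - 1`
  has all derivatives `≤ C min(1, r)` on an annulus, uniformly in `r ≥ 0`;
* `exists_eLpNormDistrib_heatSemigroup_sub_lpBlock_le`: **`‖(e^{hΔ} - 1)Δ̇_j u‖_{L^p} ≤
  C min(1, 2^{2j}h) ‖Δ̇_j u‖_{L^p}`** (BCD, proof of Lemma 2.4), hence for the Besov weights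
  (`lpBlockWeight_heatSemigroup_sub_le`, `eHomBesovNorm_heatSemigroup_sub_le`);
* `tendsto_eLpNorm_count_mul_of_dominated`: dominated convergence in `ℓ^q(ℤ)`, `0 < q < ∞`, for
  damped sequences, and `tendsto_eLpNorm_count_heatDamping_mul` for the dampings `min(1, 2^{2j}h)`;
* `eventually_eHomBesovNorm_heatSemigroup_sub_le_of_profile`: **uniform strong continuity on
  profile-dominated sets** — for `b ∈ ℓ^q(ℤ)` and `ε > 0`, `‖e^{hΔ}u - u‖_{Ḃ^s_{p,q}} ≤ ε` for all
  small `h ≥ 0` simultaneously for all `u` with `2^{js}‖Δ̇_j u‖_{L^p} ≤ b_j` (the equicontinuity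
  needed for the *left* continuity in time of Duhamel terms `t ↦ B(u,u)(t)` in `Ḃ^{s_p}_{p,q}`,
  whose blocks obey a fixed parabolic profile);
* `MemHomBesov.tendsto_eHomBesovNorm_heatSemigroup_sub_self`,
  `MemHomBesov.tendsto_eHomBesovNorm_heatSemigroup_sub_heatSemigroup`: `e^{tΔ}` is strongly
  continuous on `Ḃ^s_{p,q}`, `0 < q < ∞`, and `t ↦ e^{tΔ}u` is continuous on `[0, ∞)` in
  `Ḃ^s_{p,q}`;
* `MemHomBesov.tendsto_rpow_mul_eLpNormDistrib_heatSemigroup`: for `u ∈ Ḃ^{-σ}_{p,q}`, `σ > 0`,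
  `0 < q < ∞`: **`t^{σ/2}‖e^{tΔ}u‖_{L^p} → 0` as `t → 0⁺`** (the `o(1)` companion of the tree's
  `O(1)` bound `exists_eLpNormDistrib_heatSemigroup_le_rpow_mul_eHomBesovNorm`; the weights
  `2^{-jσ}‖Δ̇_j u‖_{L^p}` tend to `0` at `j → ±∞` and the parabolic dampings have bounded sum,
  `tendsto_tsum_mul_of_tendsto_cofinite`), with the `∃ T` form
  `MemHomBesov.exists_forall_rpow_mul_eLpNormDistrib_heatSemigroup_le`.

Relation to the tree. `Literature/Analysis/FluidPDE/BesovHeatContinuity.lean`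
(`tendsto_eHomBesovNorm_heatSemigroup_sub`) proves the continuity of the heat path for
`1 ≤ p < ∞`, `1 ≤ q < ∞` through the Gauss–Weierstrass semigroup on the `L^p` blocks, and
`Literature/Analysis/FluidPDE/BesovFreeEvolution.lean`
(`tendsto_rpow_mul_eLpNormDistrib_heatSemigroup_nhdsGT_zero`) proves the Kato smallness for
`1 ≤ q < ∞` by Hölder in `ℓ^{r'} × ℓ^r`. The statements here cover `p = ∞` (the `K_∞` weight
`√t‖e^{tΔ}u₀‖_∞ → 0` for `u₀ ∈ Ḃ^{-1}_{∞,q}` directly) and `0 < q < 1`, give the blockwise rate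
`min(1, 2^{2j}h)` and the profile-uniform version, and use only the symbol calculus on the blocks.
They serve the local Cauchy theory of the Navier–Stokes equations in `Ḃ^{-1+3/p}_{p,q}`
(`Literature.Analysis.FluidPDE.exists_isBesovMildSolutionOn`, BCD Thm. 5.40; Gallagher–Koch–Planchon
2016, §1.2: `NS(u₀) ∈ C([0,T]; Ḃ^{s_p}_{p,q})`, `q < ∞`).

## References

* H. Bahouri, J.-Y. Chemin, R. Danchin, *Fourier Analysis and Nonlinear Partial Differential
  Equations*, Grundlehren 343, Springer (2011), Lemma 2.4 and its proof, Thm. 2.34, §5.6.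
  [BahouriCheminDanchin2011]
* I. Gallagher, G. S. Koch, F. Planchon, *Blow-up of critical Besov norms at a potential
  Navier–Stokes singularity*, Comm. Math. Phys. 343 (2016) = arXiv:1407.4156, §1.2 and App. B.
  [GKP2016]
-/

noncomputable section

open MeasureTheory TemperedDistribution SchwartzMap Filter Topology Function
open scoped SchwartzMap ENNReal NNReal FourierTransform Real ContDiff

namespace Literature.Analysis.FunctionSpaces

section SymbolBounds

/-- `|e^{-y} - 1| ≤ min 1 y` for `0 ≤ y`. [folklore] -/
theorem abs_exp_neg_sub_one_le {y : ℝ} (hy : 0 ≤ y) : |Real.exp (-y) - 1| ≤ min 1 y := by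
  have h1 : Real.exp (-y) ≤ 1 := Real.exp_le_one_iff.mpr (by linarith)
  have h2 : 0 < Real.exp (-y) := Real.exp_pos _
  have h3 : -y + 1 ≤ Real.exp (-y) := Real.add_one_le_exp (-y)
  rw [abs_sub_comm, abs_of_nonneg (by linarith)]
  exact le_min (by linarith) (by linarith)

/-- Derivatives of `y ↦ (e^{c y} : ℂ) - 1` on `ℝ`: for `1 ≤ i`, `‖Dⁱ (e^{c·} - 1)(y)‖ ≤ |c|ⁱ e^{c y}`
(the constant disappears). [folklore] -/
theorem norm_iteratedFDeriv_ofReal_exp_const_mul_sub_one_le (c : ℝ) {i : ℕ} (hi : 1 ≤ i) (y : ℝ) :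
    ‖iteratedFDeriv ℝ i (fun s : ℝ => ((Real.exp (c * s) : ℝ) : ℂ) - 1) y‖ ≤
      |c| ^ i * Real.exp (c * y) := by
  have hf : ContDiff ℝ i (fun s : ℝ => ((Real.exp (c * s) : ℝ) : ℂ)) :=
    (contDiff_ofReal_exp_const_mul c).of_le (mod_cast le_top)
  have hg : ContDiff ℝ i (fun _ : ℝ => (1 : ℂ)) := contDiff_const
  have heq : (fun s : ℝ => ((Real.exp (c * s) : ℝ) : ℂ) - 1) =
      (fun s : ℝ => ((Real.exp (c * s) : ℝ) : ℂ)) - fun _ : ℝ => (1 : ℂ) := rfl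
  rw [heq, iteratedFDeriv_sub hf hg, iteratedFDeriv_const_of_ne (by omega), sub_zero]
  exact norm_iteratedFDeriv_ofReal_exp_const_mul_le c i y

variable {E : Type*} [NormedAddCommGroup E] [InnerProductSpace ℝ E]

omit [InnerProductSpace ℝ E] in
/-- The difference symbol as a composition `(y ↦ e^{c y} - 1) ∘ ‖·‖²`, `c = -(2π)² r`. [folklore] -/
theorem heatSymbol_sub_one_complex_eq_comp (r : ℝ) :
    (fun ξ : E => (UnboundedOperators.heatSymbol r ξ : ℂ) - 1) =
      (fun s : ℝ => ((Real.exp (-(2 * π) ^ 2 * r * s) : ℝ) : ℂ) - 1) ∘ fun ξ : E => ‖ξ‖ ^ 2 := by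
  funext ξ
  simp only [comp_apply, UnboundedOperators.heatSymbol]

/-- **Derivatives of the difference symbol `e^{-(2π)² r‖ξ‖²} - 1` of `e^{rΔ} - 1` on an annulus**:
for `0 < a₀`, `R`, `n` there is `C` such that for all `r ≥ 0`, `N ≤ n` and `a₀ ≤ ‖x‖ ≤ R`,
`‖D^N (e^{-(2π)² r ‖·‖²} - 1)(x)‖ ≤ C min(1, r)`: for small `r` every term of the Faà di Bruno
expansion carries a factor `r` (and `|e^{-y} - 1| ≤ y` at order `0`), for large `r` the bound of
`norm_iteratedFDeriv_heatSymbol_le_exp_neg` applies. This is the symbol estimate behind the strong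
continuity of the heat semigroup on the dyadic blocks (BCD, proof of Lemma 2.4). [folklore] -/
theorem norm_iteratedFDeriv_heatSymbol_sub_one_le {a₀ : ℝ} (ha₀ : 0 < a₀) (R : ℝ) (n : ℕ) :
    ∃ C : ℝ, 0 ≤ C ∧ ∀ r : ℝ, 0 ≤ r → ∀ N ≤ n, ∀ x : E, a₀ ≤ ‖x‖ → ‖x‖ ≤ R →
      ‖iteratedFDeriv ℝ N (fun ξ : E => (UnboundedOperators.heatSymbol r ξ : ℂ) - 1) x‖ ≤
        C * min 1 r := by
  obtain ⟨C₁, hC₁0, hC₁⟩ := norm_iteratedFDeriv_heatSymbol_le_exp_neg (E := E) ha₀ R n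
  set a : ℝ := (2 * π) ^ 2 with ha
  have ha0 : 0 < a := by positivity
  set D : ℝ := max (2 * R) 2 with hD
  set Cs : ℝ := n.factorial * (max (R ^ 2) 1 * a) * D ^ n with hCs
  have hCs0 : 0 ≤ Cs := by positivity
  set m₀ : ℝ := min 1 a⁻¹ with hm₀
  have hm₀0 : 0 < m₀ := lt_min one_pos (inv_pos.2 ha0)
  refine ⟨Cs * max 1 a⁻¹ + (C₁ + 1) / m₀, by positivity, fun r hr N hN x hx hxR => ?_⟩
  have hmin0 : 0 ≤ min 1 r := le_min zero_le_one hr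
  by_cases hra : r ≤ a⁻¹
  · -- small times: every derivative is `O(r)`
    have har : a * r ≤ 1 := by
      calc a * r ≤ a * a⁻¹ := mul_le_mul_of_nonneg_left hra ha0.le
        _ = 1 := mul_inv_cancel₀ ha0.ne'
    have hg : ContDiff ℝ ∞ (fun s : ℝ => ((Real.exp (-(2 * π) ^ 2 * r * s) : ℝ) : ℂ) - 1) :=
      (contDiff_ofReal_exp_const_mul _).sub contDiff_const
    have hf : ContDiff ℝ ∞ (fun ξ : E => ‖ξ‖ ^ 2) := contDiff_norm_sq ℝ
    have hDx : max (2 * ‖x‖) 2 ≤ D := max_le_max (by linarith) le_rfl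
    have hD0 : 0 ≤ max (2 * ‖x‖) 2 := le_max_of_le_right zero_le_two
    have hR0 : 0 ≤ R := (norm_nonneg x).trans hxR
    have hx2 : ‖x‖ ^ 2 ≤ max (R ^ 2) 1 :=
      (pow_le_pow_left₀ (norm_nonneg x) hxR 2).trans (le_max_left _ _)
    have habs : |-(2 * π) ^ 2 * r| = a * r := by
      rw [← ha, show -a * r = -(a * r) by ring, abs_neg, abs_of_nonneg (by positivity)]
    have hC : ∀ i ≤ N, ‖iteratedFDeriv ℝ i
        (fun s : ℝ => ((Real.exp (-(2 * π) ^ 2 * r * s) : ℝ) : ℂ) - 1) (‖x‖ ^ 2)‖ ≤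
        max (R ^ 2) 1 * a * r := by
      intro i hi
      rcases Nat.eq_zero_or_pos i with rfl | hi1
      · rw [norm_iteratedFDeriv_zero]
        have hy : 0 ≤ a * r * ‖x‖ ^ 2 := by positivity
        calc ‖((Real.exp (-(2 * π) ^ 2 * r * ‖x‖ ^ 2) : ℝ) : ℂ) - 1‖
            = |Real.exp (-(a * r * ‖x‖ ^ 2)) - 1| := by
              rw [← Complex.ofReal_one, ← Complex.ofReal_sub, Complex.norm_real, Real.norm_eq_abs,
                ha]; ring_nf
          _ ≤ min 1 (a * r * ‖x‖ ^ 2) := abs_exp_neg_sub_one_le hy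
          _ ≤ a * r * ‖x‖ ^ 2 := min_le_right _ _
          _ ≤ a * r * max (R ^ 2) 1 := by gcongr
          _ = max (R ^ 2) 1 * a * r := by ring
      · calc ‖iteratedFDeriv ℝ i
              (fun s : ℝ => ((Real.exp (-(2 * π) ^ 2 * r * s) : ℝ) : ℂ) - 1) (‖x‖ ^ 2)‖
            ≤ |-(2 * π) ^ 2 * r| ^ i * Real.exp (-(2 * π) ^ 2 * r * ‖x‖ ^ 2) :=
              norm_iteratedFDeriv_ofReal_exp_const_mul_sub_one_le _ hi1 _
          _ ≤ (a * r) ^ i * 1 := by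
              rw [habs]
              gcongr
              rw [Real.exp_le_one_iff]
              have : 0 ≤ (2 * π) ^ 2 * r * ‖x‖ ^ 2 := by positivity
              linarith
          _ ≤ a * r := by
              rw [mul_one]
              calc (a * r) ^ i ≤ (a * r) ^ 1 := pow_le_pow_of_le_one (by positivity) har hi1
                _ = a * r := pow_one _
          _ ≤ max (R ^ 2) 1 * a * r := by
              rw [mul_assoc]
              exact le_mul_of_one_le_left (by positivity) (le_max_right _ _)
    have hDb : ∀ i, 1 ≤ i → i ≤ N → ‖iteratedFDeriv ℝ i (fun ξ : E => ‖ξ‖ ^ 2) x‖ ≤ D ^ i :=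
      fun i hi _ => (norm_iteratedFDeriv_norm_sq_le x hi).trans (pow_le_pow_left₀ hD0 hDx i)
    rw [heatSymbol_sub_one_complex_eq_comp]
    have hmain := norm_iteratedFDeriv_comp_le hg hf (mod_cast le_top) x hC hDb
    refine hmain.trans ?_
    have hD1 : 1 ≤ D := le_max_of_le_right one_le_two
    have hNf : (N.factorial : ℝ) ≤ n.factorial := by exact_mod_cast Nat.factorial_le hN
    have hrle : r ≤ max 1 a⁻¹ * min 1 r := by
      rcases le_total r 1 with h1 | h1
      · rw [min_eq_right h1]
        exact le_mul_of_one_le_left hr (le_max_left _ _)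
      · rw [min_eq_left h1, mul_one]
        exact hra.trans (le_max_right _ _)
    calc (N.factorial : ℝ) * (max (R ^ 2) 1 * a * r) * D ^ N
        ≤ n.factorial * (max (R ^ 2) 1 * a * r) * D ^ n := by
          gcongr
      _ = Cs * r := by rw [hCs]; ring
      _ ≤ Cs * (max 1 a⁻¹ * min 1 r) := mul_le_mul_of_nonneg_left hrle hCs0
      _ = Cs * max 1 a⁻¹ * min 1 r := by ring
      _ ≤ (Cs * max 1 a⁻¹ + (C₁ + 1) / m₀) * min 1 r := by
          gcongr
          exact le_add_of_nonneg_right (by positivity)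
  · -- large times: the heat symbol estimate plus the constant
    push Not at hra
    have hm₀r : m₀ ≤ min 1 r := by
      rw [hm₀]
      exact min_le_min le_rfl hra.le
    have hf : ContDiff ℝ N (fun ξ : E => (UnboundedOperators.heatSymbol r ξ : ℂ)) :=
      ((UnboundedOperators.heatSymbol_hasTemperateGrowth_complex
        UnboundedOperators.heatSymbol_hasTemperateGrowth_holds hr).1).of_le (mod_cast le_top)
    have hg : ContDiff ℝ N (fun _ : E => (1 : ℂ)) := contDiff_const
    have heq : (fun ξ : E => (UnboundedOperators.heatSymbol r ξ : ℂ) - 1) =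
        (fun ξ : E => (UnboundedOperators.heatSymbol r ξ : ℂ)) - fun _ : E => (1 : ℂ) := rfl
    have hconst : ‖iteratedFDeriv ℝ N (fun _ : E => (1 : ℂ)) x‖ ≤ 1 := by
      rcases Nat.eq_zero_or_pos N with rfl | hN1
      · simp
      · rw [iteratedFDeriv_const_of_ne (by omega)]
        simp
    calc ‖iteratedFDeriv ℝ N (fun ξ : E => (UnboundedOperators.heatSymbol r ξ : ℂ) - 1) x‖
        = ‖iteratedFDeriv ℝ N (fun ξ : E => (UnboundedOperators.heatSymbol r ξ : ℂ)) x -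
            iteratedFDeriv ℝ N (fun _ : E => (1 : ℂ)) x‖ := by
          rw [heq, iteratedFDeriv_sub hf hg]; rfl
      _ ≤ ‖iteratedFDeriv ℝ N (fun ξ : E => (UnboundedOperators.heatSymbol r ξ : ℂ)) x‖ +
            ‖iteratedFDeriv ℝ N (fun _ : E => (1 : ℂ)) x‖ := norm_sub_le _ _
      _ ≤ C₁ * Real.exp (-((2 * π) ^ 2 * a₀ ^ 2 / 2) * r) + 1 := add_le_add (hC₁ r hr N hN x hx hxR) hconst
      _ ≤ C₁ * 1 + 1 := by
          gcongr
          rw [Real.exp_le_one_iff]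
          have : 0 ≤ (2 * π) ^ 2 * a₀ ^ 2 / 2 * r := by positivity
          linarith
      _ = (C₁ + 1) / m₀ * m₀ := by rw [mul_one, div_mul_cancel₀ _ hm₀0.ne']
      _ ≤ (C₁ + 1) / m₀ * min 1 r := by gcongr
      _ ≤ (Cs * max 1 a⁻¹ + (C₁ + 1) / m₀) * min 1 r := by
          gcongr
          exact le_add_of_nonneg_left (by positivity)

end SymbolBounds

end Literature.Analysis.FunctionSpaces

namespace Literature.Analysis.FunctionSpaces

/-! ## Blockwise strong continuity: `‖(e^{hΔ} - 1) Δ̇_j u‖_{L^p} ≤ C min(1, 4^j h) ‖Δ̇_j u‖_{L^p}` -/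

section Blocks

variable {E : Type*} [NormedAddCommGroup E] [InnerProductSpace ℝ E] [FiniteDimensional ℝ E]
  [MeasurableSpace E] [BorelSpace E] {F : Type*} [NormedAddCommGroup F] [NormedSpace ℂ F]

/-- The Fourier multiplier on `𝓢'` is additive in the symbol: `(g₁ - g₂)(D) = g₁(D) - g₂(D)` for
symbols of temperate growth. [folklore] -/
theorem fourierMultiplierCLM_symbol_sub {g₁ g₂ : E → ℂ} (hg₁ : g₁.HasTemperateGrowth)
    (hg₂ : g₂.HasTemperateGrowth) (v : 𝓢'(E, F)) :
    TemperedDistribution.fourierMultiplierCLM F (g₁ - g₂) v =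
      TemperedDistribution.fourierMultiplierCLM F g₁ v -
        TemperedDistribution.fourierMultiplierCLM F g₂ v := by
  ext φ
  simp only [sub_apply, TemperedDistribution.fourierMultiplierCLM_apply_apply]
  rw [SchwartzMap.smulLeftCLM_sub hg₁ hg₂, sub_apply, sub_eq_add_neg, FourierAdd.fourier_add,
    FourierTransform.fourier_neg, map_add, map_neg, sub_eq_add_neg]

/-- `e^{hΔ} v - v = (e^{-(2π)² h‖·‖²} - 1)(D) v` on `𝓢'(E, F)` for `0 ≤ h` (linearity of the
multiplier in the symbol). [folklore] -/
theorem heatSemigroup_sub_self_eq_fourierMultiplierCLM {h : ℝ} (hh : 0 ≤ h) (v : 𝓢'(E, F)) :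
    TemperedDistribution.heatSemigroup h v - v =
      fourierMultiplierCLM F (fun ξ : E => (UnboundedOperators.heatSymbol h ξ : ℂ) - 1) v := by
  have hG := UnboundedOperators.heatSymbol_hasTemperateGrowth_complex (E := E)
    UnboundedOperators.heatSymbol_hasTemperateGrowth_holds hh
  have h1 : (fun _ : E => (1 : ℂ)).HasTemperateGrowth := Function.HasTemperateGrowth.const 1
  have heq : (fun ξ : E => (UnboundedOperators.heatSymbol h ξ : ℂ) - 1) =
      (fun ξ : E => (UnboundedOperators.heatSymbol h ξ : ℂ)) - fun _ : E => (1 : ℂ) := rfl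
  rw [heq, fourierMultiplierCLM_symbol_sub hG h1,
    ← TemperedDistribution.heatSemigroup_eq_fourierMultiplierCLM,
    TemperedDistribution.fourierMultiplierCLM_const]
  simp

variable [CompleteSpace F]

/-- **Strong continuity of the heat semigroup on the dyadic blocks** (BCD, proof of Lemma 2.4;
the estimate `‖(e^{tΔ} - 1) Δ̇_j u‖_{L^p} ≲ min(1, t 2^{2j}) ‖Δ̇_j u‖_{L^p}` used for the time
continuity of solutions in `Ḃ^s_{p,q}`): for `1 ≤ p ≤ ∞` there is `C` with
`‖e^{hΔ} Δ̇_j u - Δ̇_j u‖_{L^p} ≤ C min(1, 2^{2j} h) ‖Δ̇_j u‖_{L^p}` for all `h ≥ 0`, `j ∈ ℤ`,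
`u ∈ 𝓢'(E, F)` — the general multiplier lemma on the blocks
(`exists_eLpNormDistrib_fourierMultiplierCLM_lpBlock_le`) for the symbol `e^{-(2π)²h‖ξ‖²} - 1`,
whose rescaling `g(2^j ·)` is the same symbol at time `4^j h`
(`norm_iteratedFDeriv_heatSymbol_sub_one_le`). [cite: BahouriCheminDanchin2011, Lemma 2.4] -/
theorem exists_eLpNormDistrib_heatSemigroup_sub_lpBlock_le (p : ℝ≥0∞) [Fact (1 ≤ p)] :
    ∃ C : ℝ≥0, ∀ h : ℝ, 0 ≤ h → ∀ (j : ℤ) (u : 𝓢'(E, F)),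
      eLpNormDistrib p (TemperedDistribution.heatSemigroup h (lpBlock j u) - lpBlock j u) ≤
        C * ENNReal.ofReal (min 1 (2 ^ (2 * j) * h)) * eLpNormDistrib p (lpBlock j u) := by
  obtain ⟨n, C, hC⟩ := exists_eLpNormDistrib_fourierMultiplierCLM_lpBlock_le (E := E) (F := F) p
  obtain ⟨C₁, hC₁0, hC₁⟩ :=
    norm_iteratedFDeriv_heatSymbol_sub_one_le (E := E) (a₀ := 4⁻¹) (by norm_num) 4 n
  refine ⟨C * C₁.toNNReal, fun h hh j u => ?_⟩
  have hG : (fun ξ : E => (UnboundedOperators.heatSymbol h ξ : ℂ) - 1).HasTemperateGrowth :=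
    (UnboundedOperators.heatSymbol_hasTemperateGrowth_complex
      UnboundedOperators.heatSymbol_hasTemperateGrowth_holds hh).sub (Function.HasTemperateGrowth.const 1)
  have h4h : 0 ≤ (2 : ℝ) ^ (2 * j) * h := by positivity
  have hresc : (fun ξ : E => (UnboundedOperators.heatSymbol h (((2 : ℝ) ^ j) • ξ) : ℂ) - 1) =
      fun ξ : E => (UnboundedOperators.heatSymbol ((2 : ℝ) ^ (2 * j) * h) ξ : ℂ) - 1 := by
    funext ξ
    rw [heatSymbol_smul, ← two_zpow_two_mul]
  have hB : ∀ N ≤ n, ∀ x ∈ blockAnnulus E,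
      ‖iteratedFDeriv ℝ N (fun ξ : E => (UnboundedOperators.heatSymbol h (((2 : ℝ) ^ j) • ξ) : ℂ) - 1) x‖ ≤
        C₁ * min 1 ((2 : ℝ) ^ (2 * j) * h) := by
    intro N hN x hx
    rw [hresc]
    exact hC₁ _ h4h N hN x hx.1 hx.2
  have hmain := hC _ hG j (C₁ * min 1 ((2 : ℝ) ^ (2 * j) * h)) (by positivity) hB u
  rw [heatSemigroup_sub_self_eq_fourierMultiplierCLM hh]
  refine hmain.trans (le_of_eq ?_)
  rw [ENNReal.ofReal_mul hC₁0, ENNReal.coe_mul]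
  simp only [ENNReal.ofReal, mul_assoc]

/-- The Besov weights of `e^{hΔ} u - u`:
`2^{js} ‖Δ̇_j (e^{hΔ} u - u)‖_{L^p} ≤ C min(1, 2^{2j} h) · 2^{js} ‖Δ̇_j u‖_{L^p}`.
[cite: BahouriCheminDanchin2011, Lemma 2.4] -/
theorem lpBlockWeight_heatSemigroup_sub_le {p : ℝ≥0∞} [Fact (1 ≤ p)] {C : ℝ≥0}
    (hC : ∀ h : ℝ, 0 ≤ h → ∀ (j : ℤ) (u : 𝓢'(E, F)),
      eLpNormDistrib p (TemperedDistribution.heatSemigroup h (lpBlock j u) - lpBlock j u) ≤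
        C * ENNReal.ofReal (min 1 (2 ^ (2 * j) * h)) * eLpNormDistrib p (lpBlock j u))
    (s : ℝ) {h : ℝ} (hh : 0 ≤ h) (u : 𝓢'(E, F)) (j : ℤ) :
    lpBlockWeight s p (TemperedDistribution.heatSemigroup h u - u) j ≤
      C * ENNReal.ofReal (min 1 (2 ^ (2 * j) * h)) * lpBlockWeight s p u j := by
  simp only [lpBlockWeight]
  rw [map_sub, lpBlock_heatSemigroup_comm hh]
  calc (2 : ℝ≥0∞) ^ ((j : ℝ) * s) *
        eLpNormDistrib p (TemperedDistribution.heatSemigroup h (lpBlock j u) - lpBlock j u)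
      ≤ (2 : ℝ≥0∞) ^ ((j : ℝ) * s) *
          (C * ENNReal.ofReal (min 1 (2 ^ (2 * j) * h)) * eLpNormDistrib p (lpBlock j u)) := by
        gcongr
        exact hC h hh j u
    _ = C * ENNReal.ofReal (min 1 (2 ^ (2 * j) * h)) *
          ((2 : ℝ≥0∞) ^ ((j : ℝ) * s) * eLpNormDistrib p (lpBlock j u)) := by ring

/-- The Besov norm of `e^{hΔ} u - u` is dominated by the `ℓ^q` norm of the damped weights
`C min(1, 2^{2j} h) · 2^{js} ‖Δ̇_j u‖_{L^p}`. [cite: BahouriCheminDanchin2011, Lemma 2.4] -/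
theorem eHomBesovNorm_heatSemigroup_sub_le {p : ℝ≥0∞} [Fact (1 ≤ p)] {C : ℝ≥0}
    (hC : ∀ h : ℝ, 0 ≤ h → ∀ (j : ℤ) (u : 𝓢'(E, F)),
      eLpNormDistrib p (TemperedDistribution.heatSemigroup h (lpBlock j u) - lpBlock j u) ≤
        C * ENNReal.ofReal (min 1 (2 ^ (2 * j) * h)) * eLpNormDistrib p (lpBlock j u))
    (s : ℝ) (q : ℝ≥0∞) {h : ℝ} (hh : 0 ≤ h) (u : 𝓢'(E, F)) :
    eHomBesovNorm s p q (TemperedDistribution.heatSemigroup h u - u) ≤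
      eLpNorm (fun j : ℤ => (C : ℝ≥0∞) * ENNReal.ofReal (min 1 (2 ^ (2 * j) * h)) *
        lpBlockWeight s p u j) q Measure.count := by
  unfold eHomBesovNorm
  refine eLpNorm_mono_enorm fun j => ?_
  simp only [enorm_eq_self]
  exact lpBlockWeight_heatSemigroup_sub_le hC s hh u j

end Blocks

/-! ## `ℓ^q` dominated convergence and the strong continuity on `Ḃ^s_{p,q}`, `q < ∞` -/

section Continuity

/-- **`ℓ^q(ℤ)` dominated convergence for damped sequences**: if `b ∈ ℓ^q(ℤ)` (`0 < q < ∞`, values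
in `[0, ∞]`) and the dampings `m_i(j) ≤ M < ∞` tend to `0` for each `j` along a countably generated
filter, then `‖(m_i(j) b_j)_j‖_{ℓ^q} → 0`. (False for `q = ∞`.) [folklore] -/
theorem tendsto_eLpNorm_count_mul_of_dominated {ι : Type*} {l : Filter ι} [l.IsCountablyGenerated]
    {q : ℝ≥0∞} (hq₀ : q ≠ 0) (hq : q ≠ ⊤) {b : ℤ → ℝ≥0∞} (hb : eLpNorm b q Measure.count < ⊤)
    {m : ι → ℤ → ℝ≥0∞} {M : ℝ≥0∞} (hM : M ≠ ⊤) (hmM : ∀ i j, m i j ≤ M)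
    (hm : ∀ j, Tendsto (fun i => m i j) l (𝓝 0)) :
    Tendsto (fun i => eLpNorm (fun j => m i j * b j) q Measure.count) l (𝓝 0) := by
  have hqr : 0 < q.toReal := ENNReal.toReal_pos hq₀ hq
  have hint : ∫⁻ j, ‖b j‖ₑ ^ q.toReal ∂Measure.count < ⊤ :=
    lintegral_rpow_enorm_lt_top_of_eLpNorm_lt_top hq₀ hq hb
  simp only [enorm_eq_self] at hint
  have hbj : ∀ j, b j < ⊤ := by
    intro j
    rw [lintegral_count] at hint
    have h := ENNReal.lt_top_of_tsum_ne_top hint.ne j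
    exact (ENNReal.rpow_lt_top_iff_of_pos hqr).1 h
  simp_rw [eLpNorm_eq_lintegral_rpow_enorm_toReal hq₀ hq, enorm_eq_self]
  have h0 : (0 : ℝ≥0∞) = 0 ^ (1 / q.toReal) := by rw [ENNReal.zero_rpow_of_pos (by positivity)]
  rw [h0]
  refine ((ENNReal.continuous_rpow_const.tendsto 0).comp ?_)
  have hbound : ∫⁻ j, (M * b j) ^ q.toReal ∂Measure.count ≠ ⊤ := by
    simp_rw [ENNReal.mul_rpow_of_nonneg _ _ hqr.le]
    rw [lintegral_const_mul' _ _ (ENNReal.rpow_ne_top_of_nonneg hqr.le hM)]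
    exact ENNReal.mul_ne_top (ENNReal.rpow_ne_top_of_nonneg hqr.le hM) hint.ne
  have hle : ∀ i j, (m i j * b j) ^ q.toReal ≤ (M * b j) ^ q.toReal := by
    intro i j
    gcongr
    exact hmM i j
  have hlim : ∀ j, Tendsto (fun i => (m i j * b j) ^ q.toReal) l (𝓝 0) := by
    intro j
    have h1 : Tendsto (fun i => m i j * b j) l (𝓝 (0 * b j)) :=
      ENNReal.Tendsto.mul_const (hm j) (Or.inr (hbj j).ne)
    rw [zero_mul] at h1
    have h2 := ((ENNReal.continuous_rpow_const (y := q.toReal)).tendsto 0).comp h1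
    rwa [ENNReal.zero_rpow_of_pos hqr] at h2
  have key := tendsto_lintegral_filter_of_dominated_convergence (μ := Measure.count) (l := l)
    (F := fun i j => (m i j * b j) ^ q.toReal) (f := fun _ => 0) (fun j => (M * b j) ^ q.toReal)
    (Eventually.of_forall fun i => Measurable.of_discrete)
    (Eventually.of_forall fun i => ae_of_all _ fun j => hle i j) hbound (ae_of_all _ fun j => hlim j)
  simpa only [lintegral_zero] using key

/-- The damped weights of the heat flow tend to zero in `ℓ^q`, uniformly on a profile:
`‖(C min(1, 2^{2j} h) b_j)_j‖_{ℓ^q} → 0` as `h → 0⁺` for `b ∈ ℓ^q(ℤ)`, `0 < q < ∞`. [folklore] -/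
theorem tendsto_eLpNorm_count_heatDamping_mul {q : ℝ≥0∞} (hq₀ : q ≠ 0) (hq : q ≠ ⊤)
    {b : ℤ → ℝ≥0∞} (hb : eLpNorm b q Measure.count < ⊤) (C : ℝ≥0) :
    Tendsto (fun h : ℝ => eLpNorm (fun j : ℤ => (C : ℝ≥0∞) * ENNReal.ofReal (min 1 (2 ^ (2 * j) * h)) *
      b j) q Measure.count) (𝓝[≥] 0) (𝓝 0) := by
  refine tendsto_eLpNorm_count_mul_of_dominated (l := 𝓝[≥] (0 : ℝ)) hq₀ hq hb (M := C)
    ENNReal.coe_ne_top (fun h j => ?_) (fun j => ?_)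
  · calc (C : ℝ≥0∞) * ENNReal.ofReal (min 1 (2 ^ (2 * j) * h)) ≤ C * 1 := by
          gcongr
          rw [ENNReal.ofReal_le_one]
          exact min_le_left _ _
      _ = C := mul_one _
  · have hc : Continuous fun h : ℝ => (C : ℝ≥0∞) * ENNReal.ofReal (min 1 (2 ^ (2 * j) * h)) :=
      ENNReal.continuous_const_mul ENNReal.coe_ne_top |>.comp
        (ENNReal.continuous_ofReal.comp (continuous_const.min (continuous_const.mul continuous_id)))
    have h0 := hc.tendsto 0
    simp only [mul_zero, min_eq_right zero_le_one, ENNReal.ofReal_zero] at h0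
    exact tendsto_nhdsWithin_of_tendsto_nhds h0

variable {E : Type*} [NormedAddCommGroup E] [InnerProductSpace ℝ E] [FiniteDimensional ℝ E]
  [MeasurableSpace E] [BorelSpace E] {F : Type*} [NormedAddCommGroup F] [NormedSpace ℂ F]
  [CompleteSpace F]

/-- **Uniform strong continuity of the heat semigroup on profile-dominated subsets of
`Ḃ^s_{p,q}`**, `0 < q < ∞`: if `b ∈ ℓ^q(ℤ)`, then for every `ε > 0` there is a neighbourhood of
`0⁺` in which `‖e^{hΔ} u - u‖_{Ḃ^s_{p,q}} ≤ ε` simultaneously for all `u` whose Besov weights are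
dominated by the profile, `2^{js} ‖Δ̇_j u‖_{L^p} ≤ b_j`. (The equicontinuity used for the time
continuity of Duhamel terms.) [cite: BahouriCheminDanchin2011, Lemma 2.4] -/
theorem eventually_eHomBesovNorm_heatSemigroup_sub_le_of_profile {s : ℝ} {p q : ℝ≥0∞}
    [Fact (1 ≤ p)] (hq₀ : q ≠ 0) (hq : q ≠ ⊤) {b : ℤ → ℝ≥0∞} (hb : eLpNorm b q Measure.count < ⊤)
    {ε : ℝ≥0∞} (hε : 0 < ε) :
    ∀ᶠ h in 𝓝[≥] (0 : ℝ), ∀ u : 𝓢'(E, F), (∀ j, lpBlockWeight s p u j ≤ b j) →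
      eHomBesovNorm s p q (TemperedDistribution.heatSemigroup h u - u) ≤ ε := by
  obtain ⟨C, hC⟩ := exists_eLpNormDistrib_heatSemigroup_sub_lpBlock_le (E := E) (F := F) p
  have ht := ENNReal.tendsto_nhds_zero.1 (tendsto_eLpNorm_count_heatDamping_mul hq₀ hq hb C) ε hε
  filter_upwards [ht, self_mem_nhdsWithin] with h hh hh0 u hu
  refine ((eHomBesovNorm_heatSemigroup_sub_le hC s q hh0 u).trans ?_).trans hh
  refine eLpNorm_mono_enorm fun j => ?_
  simp only [enorm_eq_self]
  gcongr
  exact hu j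

/-- **The heat semigroup is strongly continuous on `Ḃ^s_{p,q}` for `q < ∞`** (BCD, proof of
Thm. 2.34 / Lemma 2.4; the reason for `q < ∞` in the time continuity `u ∈ C([0,T]; Ḃ^s_{p,q})` of
Besov-space solutions): `‖e^{hΔ} u - u‖_{Ḃ^s_{p,q}} → 0` as `h → 0⁺` for `u ∈ Ḃ^s_{p,q}`,
`0 < q < ∞`. [cite: BahouriCheminDanchin2011, Lemma 2.4] -/
theorem MemHomBesov.tendsto_eHomBesovNorm_heatSemigroup_sub_self {s : ℝ} {p q : ℝ≥0∞}
    [Fact (1 ≤ p)] (hq₀ : q ≠ 0) (hq : q ≠ ⊤) {u : 𝓢'(E, F)} (hu : MemHomBesov s p q u) :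
    Tendsto (fun h : ℝ => eHomBesovNorm s p q (TemperedDistribution.heatSemigroup h u - u))
      (𝓝[≥] 0) (𝓝 0) := by
  rw [ENNReal.tendsto_nhds_zero]
  intro ε hε
  filter_upwards [eventually_eHomBesovNorm_heatSemigroup_sub_le_of_profile (E := E) (F := F)
    (s := s) (p := p) hq₀ hq hu.1 hε] with h hh
  exact hh u fun j => le_rfl

omit [CompleteSpace F] in
/-- Negation does not change the Besov weights. [folklore] -/
private theorem lpBlockWeight_neg' [CompleteSpace F] (s : ℝ) (p : ℝ≥0∞) [Fact (1 ≤ p)]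
    (u : 𝓢'(E, F)) (j : ℤ) :
    lpBlockWeight s p (-u) j = lpBlockWeight s p u j := by
  simp only [lpBlockWeight, map_neg]
  rw [show -lpBlock j u = (-1 : ℂ) • lpBlock j u by rw [neg_one_smul],
    eLpNormDistrib_const_smul (by norm_num)]
  simp

/-- Negation does not change the Besov norm. [folklore] -/
private theorem eHomBesovNorm_neg' (s : ℝ) (p q : ℝ≥0∞) [Fact (1 ≤ p)] (u : 𝓢'(E, F)) :
    eHomBesovNorm s p q (-u) = eHomBesovNorm s p q u := by
  unfold eHomBesovNorm
  congr 1
  funext j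
  exact lpBlockWeight_neg' s p u j

/-- **Continuity of the free heat path `t ↦ e^{tΔ} u` in `Ḃ^s_{p,q}`, `q < ∞`, on `[0, ∞)`**:
for `u ∈ Ḃ^s_{p,q}`, `0 < q < ∞`, and `t₀ ≥ 0`, `‖e^{tΔ} u - e^{t₀Δ} u‖_{Ḃ^s_{p,q}} → 0` as
`t → t₀` within `[0, ∞)` (semigroup law, uniform boundedness of `e^{tΔ}` on `Ḃ^s_{p,q}`, and the
strong continuity at `0⁺`). This is the free part of `NS(u₀) ∈ C([0,T); Ḃ^{s_p}_{p,q})`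
(Gallagher–Koch–Planchon 2016, §1). [cite: BahouriCheminDanchin2011, Lemma 2.4] -/
theorem MemHomBesov.tendsto_eHomBesovNorm_heatSemigroup_sub_heatSemigroup {s : ℝ} {p q : ℝ≥0∞}
    [Fact (1 ≤ p)] (hq₀ : q ≠ 0) (hq : q ≠ ⊤) {u : 𝓢'(E, F)} (hu : MemHomBesov s p q u)
    {t₀ : ℝ} (ht₀ : 0 ≤ t₀) :
    Tendsto (fun t : ℝ => eHomBesovNorm s p q
        (TemperedDistribution.heatSemigroup t u - TemperedDistribution.heatSemigroup t₀ u))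
      (𝓝[Set.Ici 0] t₀) (𝓝 0) := by
  obtain ⟨Ch, hCh⟩ := exists_eHomBesovNorm_heatSemigroup_le (E := E) (F := F) p
  have hE : UnboundedOperators.heatSymbol_hasTemperateGrowth (E := E) :=
    UnboundedOperators.heatSymbol_hasTemperateGrowth_holds
  set Φ : ℝ → ℝ≥0∞ := fun d => eHomBesovNorm s p q (TemperedDistribution.heatSemigroup d u - u)
    with hΦ
  -- the key inequality, for `t ≥ 0`
  have hkey : ∀ t : ℝ, 0 ≤ t → eHomBesovNorm s p q
      (TemperedDistribution.heatSemigroup t u - TemperedDistribution.heatSemigroup t₀ u) ≤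
      Ch * Φ |t - t₀| := by
    intro t ht
    rcases le_total t₀ t with h | h
    · have hd : 0 ≤ t - t₀ := sub_nonneg.2 h
      have hsplit : (TemperedDistribution.heatSemigroup t : 𝓢'(E, F) →L[ℂ] 𝓢'(E, F)) =
          TemperedDistribution.heatSemigroup t₀ * TemperedDistribution.heatSemigroup (t - t₀) := by
        rw [← TemperedDistribution.heatSemigroup_add hE ht₀ hd, add_sub_cancel]
      rw [abs_of_nonneg hd, hsplit, mul_apply_eq_comp, ← map_sub]
      exact hCh s q t₀ ht₀ _
    · have hd : 0 ≤ t₀ - t := sub_nonneg.2 h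
      have hsplit : (TemperedDistribution.heatSemigroup t₀ : 𝓢'(E, F) →L[ℂ] 𝓢'(E, F)) =
          TemperedDistribution.heatSemigroup t * TemperedDistribution.heatSemigroup (t₀ - t) := by
        rw [← TemperedDistribution.heatSemigroup_add hE ht hd, add_sub_cancel]
      rw [abs_sub_comm, abs_of_nonneg hd, ← eHomBesovNorm_neg', neg_sub, hsplit,
        mul_apply_eq_comp, ← map_sub]
      exact hCh s q t ht _
  -- `Φ |t - t₀| → 0`
  have hΦ0 : Tendsto Φ (𝓝[≥] 0) (𝓝 0) := hu.tendsto_eHomBesovNorm_heatSemigroup_sub_self hq₀ hq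
  have habs : Tendsto (fun t : ℝ => |t - t₀|) (𝓝 t₀) (𝓝[≥] 0) := by
    refine tendsto_nhdsWithin_iff.2 ⟨?_, Eventually.of_forall fun t => Set.mem_Ici.2 (abs_nonneg _)⟩
    have : Tendsto (fun t : ℝ => |t - t₀|) (𝓝 t₀) (𝓝 |t₀ - t₀|) :=
      (continuous_abs.tendsto _).comp (tendsto_id.sub tendsto_const_nhds)
    simpa using this
  have hcomp : Tendsto (fun t : ℝ => (Ch : ℝ≥0∞) * Φ |t - t₀|) (𝓝[Set.Ici 0] t₀) (𝓝 0) := by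
    have h1 : Tendsto (fun t : ℝ => Φ |t - t₀|) (𝓝 t₀) (𝓝 0) := hΦ0.comp habs
    have h2 := ENNReal.Tendsto.const_mul h1 (Or.inr ENNReal.coe_ne_top) (a := (Ch : ℝ≥0∞))
    rw [mul_zero] at h2
    exact h2.mono_left nhdsWithin_le_nhds
  refine tendsto_of_tendsto_of_tendsto_of_le_of_le' tendsto_const_nhds hcomp
    (Eventually.of_forall fun t => bot_le) ?_
  filter_upwards [self_mem_nhdsWithin] with t ht
  exact hkey t ht

end Continuity

end Literature.Analysis.FunctionSpaces

namespace Literature.Analysis.FunctionSpaces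

/-! ## The Kato norm of the free heat flow of `Ḃ^{-σ}_{p,q}` data is small at `t → 0⁺` (`q < ∞`) -/

section KatoSmall

/-- The parabolic damping factors `(4^j t)^a e^{-κ 4^j t}` tend to `0` as `t → 0⁺` (`0 < a`).
[folklore] -/
theorem tendsto_parabolicDamping_nhdsWithin_zero (j : ℤ) {a : ℝ} (ha : 0 < a) (κ : ℝ) :
    Tendsto (fun t : ℝ => ENNReal.ofReal (((4 : ℝ) ^ j * t) ^ a * Real.exp (-κ * ((4 : ℝ) ^ j * t))))
      (𝓝[>] 0) (𝓝 0) := by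
  have hc : Continuous fun t : ℝ => ((4 : ℝ) ^ j * t) ^ a * Real.exp (-κ * ((4 : ℝ) ^ j * t)) :=
    ((Real.continuous_rpow_const ha.le).comp (continuous_const.mul continuous_id)).mul
      (Real.continuous_exp.comp (continuous_const.mul (continuous_const.mul continuous_id)))
  have h0 := hc.tendsto 0
  simp only [mul_zero, Real.zero_rpow ha.ne', zero_mul] at h0
  have h1 := ENNReal.tendsto_ofReal h0
  rw [ENNReal.ofReal_zero] at h1
  exact tendsto_nhdsWithin_of_tendsto_nhds h1

/-- **Damped sums with coefficients tending to zero at infinity are small**: if `w_j → 0` along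
the cofinite filter of `ℤ` with all `w_j < ∞`, and the dampings `g_j(t) ∈ [0, ∞]` have
`∑_j g_j(t) ≤ K < ∞` for `t > 0` and `g_j(t) → 0` as `t → 0⁺` for each `j`, then
`∑_j g_j(t) w_j → 0` as `t → 0⁺` (split off the finitely many large `w_j`). [folklore] -/
theorem tendsto_tsum_mul_of_tendsto_cofinite {w : ℤ → ℝ≥0∞} (hw : ∀ j, w j < ⊤)
    (hw0 : Tendsto w cofinite (𝓝 0)) {g : ℤ → ℝ → ℝ≥0∞} {K : ℝ≥0∞} (hK : K ≠ ⊤)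
    (hgK : ∀ t : ℝ, 0 < t → ∑' j, g j t ≤ K) (hg0 : ∀ j, Tendsto (g j) (𝓝[>] 0) (𝓝 0)) :
    Tendsto (fun t : ℝ => ∑' j, g j t * w j) (𝓝[>] 0) (𝓝 0) := by
  rw [ENNReal.tendsto_nhds_zero]
  intro ε hε
  have hK1 : K + 1 ≠ ⊤ := by simpa using hK
  have hK10 : K + 1 ≠ 0 := by simp
  set ε' : ℝ≥0∞ := ε / 2 / (K + 1) with hε'
  have hε'0 : 0 < ε' := ENNReal.div_pos (ENNReal.half_pos hε.ne').ne' hK1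
  have hε'K : ε' * K ≤ ε / 2 := by
    calc ε' * K ≤ ε' * (K + 1) := by gcongr; exact le_self_add
      _ = ε / 2 := ENNReal.div_mul_cancel hK10 hK1
  -- the finitely many large coefficients
  have hev : ∀ᶠ j in cofinite, w j ≤ ε' := (ENNReal.tendsto_nhds_zero.1 hw0) ε' hε'0
  set S : Finset ℤ := (Filter.eventually_cofinite.1 hev).toFinset with hSdef
  have hS : ∀ j ∉ S, w j ≤ ε' := by
    intro j hj
    by_contra h
    exact hj ((Set.Finite.mem_toFinset _).2 h)
  -- the finite part tends to zero
  have hfin : Tendsto (fun t => ∑ j ∈ S, g j t * w j) (𝓝[>] 0) (𝓝 0) := by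
    have h := tendsto_finsetSum S (fun j _ => ENNReal.Tendsto.mul_const (hg0 j) (Or.inr (hw j).ne))
    simpa only [zero_mul, Finset.sum_const_zero] using h
  have hev2 := (ENNReal.tendsto_nhds_zero.1 hfin) (ε / 2) (ENNReal.half_pos hε.ne')
  filter_upwards [hev2, self_mem_nhdsWithin] with t ht1 ht0
  have hsplit : ∀ j, g j t * w j ≤ g j t * (S : Set ℤ).indicator w j + g j t * ε' := by
    intro j
    by_cases hj : j ∈ S
    · rw [Set.indicator_of_mem (Finset.mem_coe.2 hj)]
      exact le_self_add
    · rw [Set.indicator_of_notMem (fun h => hj (Finset.mem_coe.1 h)), mul_zero, zero_add]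
      exact mul_le_mul_right (hS j hj) _
  have hind : ∑' j, g j t * (S : Set ℤ).indicator w j = ∑ j ∈ S, g j t * w j := by
    rw [tsum_eq_sum (s := S) (fun j hj => by
      rw [Set.indicator_of_notMem (fun h => hj (Finset.mem_coe.1 h)), mul_zero])]
    exact Finset.sum_congr rfl fun j hj => by rw [Set.indicator_of_mem (Finset.mem_coe.2 hj)]
  calc ∑' j, g j t * w j
      ≤ ∑' j, (g j t * (S : Set ℤ).indicator w j + g j t * ε') := ENNReal.tsum_le_tsum hsplit
    _ = (∑ j ∈ S, g j t * w j) + (∑' j, g j t) * ε' := by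
        rw [ENNReal.tsum_add, ENNReal.tsum_mul_right, hind]
    _ ≤ ε / 2 + K * ε' := by
        gcongr
        · exact hgK t ht0
    _ ≤ ε / 2 + ε / 2 := by rw [mul_comm K]; gcongr
    _ = ε := ENNReal.add_halves ε

variable {E : Type*} [NormedAddCommGroup E] [InnerProductSpace ℝ E] [FiniteDimensional ℝ E]
  [MeasurableSpace E] [BorelSpace E] {F : Type*} [NormedAddCommGroup F] [NormedSpace ℂ F]
  [CompleteSpace F]

/-- The Besov weights of a distribution of finite `Ḃ^s_{p,q}` norm, `0 < q < ∞`, are finite and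
tend to `0` as `j → ±∞` (the terms of a convergent `ℓ^q` series). [folklore] -/
theorem tendsto_lpBlockWeight_cofinite {s : ℝ} {p q : ℝ≥0∞} [Fact (1 ≤ p)] (hq₀ : q ≠ 0)
    (hq : q ≠ ⊤) {u : 𝓢'(E, F)} (hu : eHomBesovNorm s p q u < ⊤) :
    (∀ j, lpBlockWeight s p u j < ⊤) ∧ Tendsto (lpBlockWeight s p u) cofinite (𝓝 0) := by
  have hqr : 0 < q.toReal := ENNReal.toReal_pos hq₀ hq
  have hint : ∫⁻ j, ‖lpBlockWeight s p u j‖ₑ ^ q.toReal ∂Measure.count < ⊤ :=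
    lintegral_rpow_enorm_lt_top_of_eLpNorm_lt_top hq₀ hq hu
  simp only [enorm_eq_self] at hint
  rw [lintegral_count] at hint
  refine ⟨fun j => (ENNReal.rpow_lt_top_iff_of_pos hqr).1 (ENNReal.lt_top_of_tsum_ne_top hint.ne j),
    ?_⟩
  have h1 : Tendsto (fun j => lpBlockWeight s p u j ^ q.toReal) cofinite (𝓝 0) :=
    ENNReal.tendsto_cofinite_zero_of_tsum_ne_top hint.ne
  have h2 := ((ENNReal.continuous_rpow_const (y := 1 / q.toReal)).tendsto 0).comp h1
  rw [ENNReal.zero_rpow_of_pos (by positivity)] at h2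
  refine h2.congr fun j => ?_
  simp only [comp_apply]
  rw [← ENNReal.rpow_mul, mul_one_div_cancel hqr.ne', ENNReal.rpow_one]

/-- **The free heat flow of `Ḃ^{-σ}_{p,q}` data is small in Kato's norm at `t → 0⁺` when
`q < ∞`** (Bahouri–Chemin–Danchin 2011, proof of Thm. 5.40 / Rem. after Thm. 2.34; the reason
local existence holds for *large* data in `Ḃ^{-1+3/p}_{p,q}`, `q < ∞`, with no smallness):
for `u ∈ Ḃ^{-σ}_{p,q}`, `σ > 0`, `0 < q < ∞`, `t^{σ/2} ‖e^{tΔ} u‖_{L^p} → 0` as `t → 0⁺`. Proof: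
`t^{σ/2} ‖e^{tΔ}u‖_{L^p} ≤ C ∑_j (4^j t)^{σ/2} e^{-c 4^j t} · 2^{-jσ}‖Δ̇_j u‖_{L^p}`, the weights
`2^{-jσ}‖Δ̇_j u‖_{L^p}` tend to `0` at `j → ±∞` (terms of an `ℓ^q` series, `q < ∞`), the dampings
have bounded sum and tend to `0` termwise (`tendsto_tsum_mul_of_tendsto_cofinite`). False for
`q = ∞` (self-similar data). [cite: BahouriCheminDanchin2011, Thm. 2.34] -/
theorem MemHomBesov.tendsto_rpow_mul_eLpNormDistrib_heatSemigroup {p q : ℝ≥0∞} [Fact (1 ≤ p)]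
    {σ : ℝ} (hσ : 0 < σ) (hq₀ : q ≠ 0) (hq : q ≠ ⊤) {u : 𝓢'(E, F)} (hu : MemHomBesov (-σ) p q u) :
    Tendsto (fun t : ℝ => ENNReal.ofReal (t ^ (σ / 2)) *
      eLpNormDistrib p (TemperedDistribution.heatSemigroup t u)) (𝓝[>] 0) (𝓝 0) := by
  obtain ⟨C, -, hC⟩ := exists_eLpNormDistrib_heatSemigroup_lpBlock_le (E := E) (F := F) p
  obtain ⟨K, hKtop, hK⟩ := exists_tsum_rpow_mul_exp_neg_le (a := σ / 2) (κ := π ^ 2 / 8)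
    (by positivity) (by positivity)
  set w : ℤ → ℝ≥0∞ := lpBlockWeight (-σ) p u with hw
  set g : ℤ → ℝ → ℝ≥0∞ := fun j t =>
    ENNReal.ofReal (((4 : ℝ) ^ j * t) ^ (σ / 2) * Real.exp (-(π ^ 2 / 8) * ((4 : ℝ) ^ j * t)))
    with hg
  obtain ⟨hwj, hw0⟩ := tendsto_lpBlockWeight_cofinite (s := -σ) hq₀ hq hu.1
  -- termwise bound, `t > 0`
  have hterm : ∀ t : ℝ, 0 < t → ∀ j : ℤ, ENNReal.ofReal (t ^ (σ / 2)) *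
      eLpNormDistrib p (lpBlock j (TemperedDistribution.heatSemigroup t u)) ≤ C * (g j t * w j) := by
    intro t ht j
    rw [lpBlock_heatSemigroup_comm ht.le]
    have hblock : eLpNormDistrib p (lpBlock j u) = (2 : ℝ≥0∞) ^ ((j : ℝ) * σ) * w j := by
      simp only [hw, lpBlockWeight]
      rw [← mul_assoc, two_rpow_mul_two_rpow, show (j : ℝ) * σ + (j : ℝ) * (-σ) = 0 by ring,
        ENNReal.rpow_zero, one_mul]
    have e1 : ENNReal.ofReal (t ^ (σ / 2)) * ENNReal.ofReal (((4 : ℝ) ^ j) ^ (σ / 2)) =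
        ENNReal.ofReal (((4 : ℝ) ^ j * t) ^ (σ / 2)) := by
      rw [← ENNReal.ofReal_mul (Real.rpow_nonneg ht.le _),
        Real.mul_rpow (zpow_nonneg (by norm_num) _) ht.le, mul_comm]
    have e2 : g j t = ENNReal.ofReal (((4 : ℝ) ^ j * t) ^ (σ / 2)) *
        ENNReal.ofReal (Real.exp (-(π ^ 2 / 8) * ((4 : ℝ) ^ j * t))) := by
      rw [hg]
      exact ENNReal.ofReal_mul (Real.rpow_nonneg (by positivity) _)
    calc ENNReal.ofReal (t ^ (σ / 2)) *
          eLpNormDistrib p (TemperedDistribution.heatSemigroup t (lpBlock j u))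
        ≤ ENNReal.ofReal (t ^ (σ / 2)) * (C * ENNReal.ofReal (Real.exp (-(π ^ 2 / 8) * 2 ^ (2 * j) * t)) *
            eLpNormDistrib p (lpBlock j u)) := by
          gcongr
          exact hC t ht.le j u
      _ = C * (g j t * w j) := by
          rw [hblock, two_rpow_int_mul_eq_ofReal_four_zpow_rpow, two_zpow_two_mul_eq_four_zpow,
            show -(π ^ 2 / 8) * (4 : ℝ) ^ j * t = -(π ^ 2 / 8) * ((4 : ℝ) ^ j * t) by ring, e2, ← e1]
          ring
  -- summation over the blocks
  have hmain : ∀ t : ℝ, 0 < t → ENNReal.ofReal (t ^ (σ / 2)) *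
      eLpNormDistrib p (TemperedDistribution.heatSemigroup t u) ≤ C * ∑' j, g j t * w j := by
    intro t ht
    have hreal := tendsto_lowFreqCutoff_heatSemigroup_atBot hu.2 ht.le
    calc ENNReal.ofReal (t ^ (σ / 2)) * eLpNormDistrib p (TemperedDistribution.heatSemigroup t u)
        ≤ ENNReal.ofReal (t ^ (σ / 2)) *
            ∑' j, eLpNormDistrib p (lpBlock j (TemperedDistribution.heatSemigroup t u)) := by
          gcongr
          exact eLpNormDistrib_le_tsum_lpBlock _ hreal
      _ = ∑' j, ENNReal.ofReal (t ^ (σ / 2)) *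
            eLpNormDistrib p (lpBlock j (TemperedDistribution.heatSemigroup t u)) := by
          rw [ENNReal.tsum_mul_left]
      _ ≤ ∑' j, C * (g j t * w j) := ENNReal.tsum_le_tsum (hterm t ht)
      _ = C * ∑' j, g j t * w j := ENNReal.tsum_mul_left
  -- the damped sum tends to zero
  have hsum : Tendsto (fun t : ℝ => ∑' j, g j t * w j) (𝓝[>] 0) (𝓝 0) :=
    tendsto_tsum_mul_of_tendsto_cofinite hwj hw0 hKtop hK
      (fun j => tendsto_parabolicDamping_nhdsWithin_zero j (by positivity) _)
  have hC0 : Tendsto (fun t : ℝ => (C : ℝ≥0∞) * ∑' j, g j t * w j) (𝓝[>] 0) (𝓝 0) := by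
    have h := ENNReal.Tendsto.const_mul hsum (Or.inr ENNReal.coe_ne_top) (a := (C : ℝ≥0∞))
    rwa [mul_zero] at h
  refine tendsto_of_tendsto_of_tendsto_of_le_of_le' tendsto_const_nhds hC0
    (Eventually.of_forall fun t => bot_le) ?_
  filter_upwards [self_mem_nhdsWithin] with t ht
  exact hmain t ht

/-- The same in the form consumed by Kato's fixed point: for every `α > 0` there is `T > 0` with
`t^{σ/2} ‖e^{tΔ} u‖_{L^p} ≤ α` for all `0 < t < T`. [cite: BahouriCheminDanchin2011, Thm. 2.34] -/
theorem MemHomBesov.exists_forall_rpow_mul_eLpNormDistrib_heatSemigroup_le {p q : ℝ≥0∞}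
    [Fact (1 ≤ p)] {σ : ℝ} (hσ : 0 < σ) (hq₀ : q ≠ 0) (hq : q ≠ ⊤) {u : 𝓢'(E, F)}
    (hu : MemHomBesov (-σ) p q u) {α : ℝ≥0∞} (hα : 0 < α) :
    ∃ T : ℝ, 0 < T ∧ ∀ t ∈ Set.Ioo 0 T, ENNReal.ofReal (t ^ (σ / 2)) *
      eLpNormDistrib p (TemperedDistribution.heatSemigroup t u) ≤ α := by
  have h := (ENNReal.tendsto_nhds_zero.1 (hu.tendsto_rpow_mul_eLpNormDistrib_heatSemigroup hσ hq₀ hq))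
    α hα
  obtain ⟨T, hT, hsub⟩ := mem_nhdsGT_iff_exists_Ioo_subset.1 h
  exact ⟨T, hT, fun t ht => hsub ht⟩

end KatoSmall

end Literature.Analysis.FunctionSpaces
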